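import Summits.QuantumFields.YangMills.Theorems.BalabanUVNodesN09MembershipDomainDoorAtRecord

/-!
# NODE N09 — door v1.3 (F-I-χ «ρ-edition»): THE N09-SIDE READING OF THE DOOR's ROW `hχregU` (the MEMBERSHIP form of the (F7a) support clause) = K0e's EXISTING pointwise
# plaquette-form clause `hχregpt` (door v1.2's row, unchanged) + ONE new displayed row `hmemχ` «fields in the support of χ^{(2.9)}_{i+1} over membership data are membership data»
# ([I] p. 265 «we define χ_k in such a way that the domain of integration is restricted to configurations V for which U_k(V) ∈ 𝔘_k(ε₀)» + [B11] Sect. G `U_k(V′V^{(k)}) = U′_k(V′)U_{k+1}`)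

TRACK A (YM-PLAN §2d, node N09 of 28), seat `pub-ymgap-dag-n09-w1` (D-0149 width seat 1∕4), generation g8, file 8 of the (G-a) set — director-ym №315 (2b) («`hχregU` — K0e's row: n09-w1 may type
its N09-side reading ONLY if plan g93 confirms no K0e pen holds it» — plan g93 ONE LINE №315 (2b): no K0e pen holds (F7a), dag-lead WORDS 148).  Key of record K1⁹ stmt-QuantumFields-27364
(`--supports … --as helper`, count-neutral).  [I] = [Balaban1987RG1] (CMP 109), [B11] = [Balaban1985Variational] (CMP 102).  Imports the door at the record (✓p747700).  THEOREMS ONLY.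

WHY.  Door v1.3 (`…N09MembershipDomainDoor` ✓p747503 ∕ `…AtRecord` ✓p747700) displays, in place of door v1.2's pointwise (F7a) clause
`hχregpt : ∀ i, i+1 < K → ∀ U, Ū ∈ domAlt_{i+2} → U ∉ regSet_i ∩ domAlt_{i+1} → χ^{(2.9)}_{i+1}(U) = 0` (K0e's analytic debt on REGULAR fields, plaquette form, [I] p. 256 l. 6 ∕ (2.1)),
its MEMBERSHIP form `hχregU` (same text with `domU^ρ` for `domAlt`).  THIS FILE reads `hχregU` as the conjunction of the OLD row and ONE new row:
  `hmemχ : ∀ i, i+1 < K → ∀ U, Ū ∈ domU_{i+2} → χ^{(2.9)}_{i+1}(U) ≠ 0 → UkExists (i+1) εbg U ∧ UniqueUkOrbit (i+1) εbg U ∧ Uk (i+1) εbg U ∈ bgReg (i+1) ρ`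
— «a field in the support of the fluctuation cut-off over a MEMBER is itself solvable-unique with a `ρ`-regular minimiser»: exactly [I] p. 265's sentence (the cut-off restricts the integration to
`U_k(V) ∈ 𝔘_k(ε₀)`), whose printed road is the perturbation formula `U_k(V′V^{(k)}) = U′_k(V′)U_{k+1}` of [I] p. 265 («As in Sect. G [15] we write …») with the analyticity of the minimiser in the datum,
[B11] Prop. 9 p. 309 ll. 7–16 (`U_{k+1}(Ū) ∈ 𝔘_{k+1}(ρ) = 𝔘_k(ρ∕L²)` leaves the room `ρ(1 − L⁻²)` for the small fluctuation `|B′| < ε₂₉`).  So the door's K0e-side debt is door v1.2's debt VERBATIM plus one [I]-p.265∕Sect.-G row — nothing else moved.  (p-2) THE FACE BINDER RE-KEYED: `hχregpt` here IS the K1 face's displayed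
N09 row (#10784 lineage; dag-n24-c's engine `hN09TF` row 4, door v1.2 :58–:62), the pointwise plaquette form keyed through K0e's threshold lemma `mem_domAltOfRecord_of_chiFix29_eq_one` (`hord`);
`hmemχ` is the NEW row.  (p-1) This is a READING: neither row is discharged here.  LETTER NOTE (director-ym №316 (2)): in K-adjacent text the membership radius is to be spelled `ϱ`∕`rMem`
(K3's texts bind `ρ ρ'` as widths, `K3V7Defs` :48∕:55); inside these N09 helper files the bound variable keeps the door's name `ρ`.
* §1 ★★ `hχregU_of_suppPt_of_memχ` (dom-generic via `hdom`) — pure logic: `χ ≠ 0` at `U` over a member ⇒ (old row, contrapositive) `U ∈ regSet_i ∩ domAlt_{i+1}` and (new row) the three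
  membership conjuncts ⇒ `U ∈ regSet_i ∩ dom (i+1)`.
* §2 (prose) the one term by which a consumer feeds the door's `hχregU` slot from (`hχregpt`, `hmemχ`) — the door's conclusions are NOT restated (gate dedup).  Displayed-row status (№300): `hχregpt` — INHABITED BY: not yet (K0e's standing analytic debt (F7a) on regular fields, unchanged since door
  v1.2); `hmemχ` — INHABITED BY: not yet ([I] p.265 ∕ [B11] Prop. 9 p.309 species; no K0e pen holds it — plan g93 №315 (2b)); `hopen` — displayed debt of record (№316 (1)); all other rows as in the door.
HONEST FRAMING: count-neutral bookkeeping BY NAME; nothing of Bałaban asserted; no record core edited ((D0)-labelled, №313 (R4)); FLAG №7′ OPEN; N09 ∕ N07 ∕ N24 NOT discharged; K0⁷ ∕ K1⁹ ∕ K3⁸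
NOT closed; counts unmoved (typed 28∕28 · discharged 8∕28); R4 = the conditional finite-𝕋⁴ rung `BalabanLadder.UV` only; the Yang–Mills mass gap (Clay) is NOT proved by any of this.
-/

noncomputable section

namespace Summit.QuantumFields.YangMills.BalabanUVNodes.N09MembershipSupportClauseReading

open MeasureTheory
open Literature.MathematicalPhysics.QuantumFieldTheory.Balaban1983to89
open Literature.MathematicalPhysics.QuantumFieldTheory.Balaban1983to89.T4Continuum (T4Family)
open Literature.MathematicalPhysics.QuantumFieldTheory.Balaban1983to89.DagBinding (WorldP leavesP)
open Literature.MathematicalPhysics.QuantumFieldTheory.Balaban1983to89.Node00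
open Literature.MathematicalPhysics.QuantumFieldTheory.Balaban1983to89.FlowStep (HBeta prefixOf RGEqH)
open Literature.MathematicalPhysics.QuantumFieldTheory.Balaban1983to89.FlowStepRuns (genSeq genFlow)
open Literature.MathematicalPhysics.QuantumFieldTheory.Balaban1983to89.ExpMeanLog (deltaSU)
open Summit.QuantumFields.YangMills.BalabanUVNodes.N09MembershipDomainDoorAtRecord

variable {F : T4Family} {N : ℕ} [NeZero N]

/-! ## §1. The membership form of (F7a) = the plaquette form + membership of the support (pure logic) -/

/-- ★★ **`hχregU` FROM `hχregpt` + `hmemχ`** (any membership family `dom`, characterised by `hdom`): if the fluctuation cut-off `χ^{(2.9)}_{i+1}` vanishes at every `U` with `Ū ∈ domAlt_{i+2}` outside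
`regSet_i ∩ domAlt_{i+1}` (door v1.2's pointwise (F7a), K0e's debt) AND every `U` in its support with `Ū ∈ dom (i+2)` is solvable-unique at `εbg` with a `ρ`-regular minimiser ([I] p. 265 «U_k(V′V^{(k)}) = U′_k(V′)U_{k+1}» ∕ [B11]
Prop. 9 p. 309), then it vanishes at every `U` with `Ū ∈ dom (i+2)` outside `regSet_i ∩ dom (i+1)` — the door's row `hχregU`.  Pure logic on the displayed rows; nothing of Bałaban asserted.
[cite: Balaban1987RG1, p.256 l.6, (2.1) p.265, p.265 and (2.9) p.266; Balaban1985Variational, Thm 1 p.279 and Prop. 9 p.309] -/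
theorem hχregU_of_suppPt_of_memχ (θ₀ : Stage13Params F N) (P : B12.RunParams) {εbg ρ : ℝ} {dom : (k : ℕ) → Set (GaugeField (F.P P.K) k (SU N))}
    (hdom : ∀ k (V : GaugeField (F.P P.K) k (SU N)), V ∈ dom k ↔
      V ∈ domAltOfRecord F N θ₀.ν P.K k ∧ UkExists F N P.K k εbg V ∧ UniqueUkOrbit F N P.K k εbg V ∧ Uk F N P.K k εbg V ∈ bgReg F N P.K k ρ)
    (hχregpt : ∀ i, i + 1 < P.K → ∀ U : GaugeField (F.P P.K) (i + 1) (SU N),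
      (avOfRecord F N P.K (i + 1)).avg U ∈ domAltOfRecord F N θ₀.ν P.K (i + 2) →
        U ∉ regSetOfRecord F N P.K i (betaInputOfRecord F N (TβOfRecord₁₃ F N) (chiβOfRecord₁₃ F N θ₀) P.K (gOfRecord₁₃ F N θ₀ P) i) ∩
            domAltOfRecord F N θ₀.ν P.K (i + 1) →
          chiβOfRecord₁₃ F N θ₀ P.K (gOfRecord₁₃ F N θ₀ P) (i + 1) U = 0)
    (hmemχ : ∀ i, i + 1 < P.K → ∀ U : GaugeField (F.P P.K) (i + 1) (SU N),
      (avOfRecord F N P.K (i + 1)).avg U ∈ dom (i + 2) →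
        chiβOfRecord₁₃ F N θ₀ P.K (gOfRecord₁₃ F N θ₀ P) (i + 1) U ≠ 0 →
          UkExists F N P.K (i + 1) εbg U ∧ UniqueUkOrbit F N P.K (i + 1) εbg U ∧ Uk F N P.K (i + 1) εbg U ∈ bgReg F N P.K (i + 1) ρ) :
    ∀ i, i + 1 < P.K → ∀ U : GaugeField (F.P P.K) (i + 1) (SU N),
      (avOfRecord F N P.K (i + 1)).avg U ∈ dom (i + 2) →
        U ∉ regSetOfRecord F N P.K i (betaInputOfRecord F N (TβOfRecord₁₃ F N) (chiβOfRecord₁₃ F N θ₀) P.K (gOfRecord₁₃ F N θ₀ P) i) ∩ dom (i + 1) →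
          chiβOfRecord₁₃ F N θ₀ P.K (gOfRecord₁₃ F N θ₀ P) (i + 1) U = 0 := by
  intro i hi U hU hnot
  by_contra hne
  have hUalt : (avOfRecord F N P.K (i + 1)).avg U ∈ domAltOfRecord F N θ₀.ν P.K (i + 2) := ((hdom (i + 2) _).1 hU).1
  have hreg : U ∈ regSetOfRecord F N P.K i (betaInputOfRecord F N (TβOfRecord₁₃ F N) (chiβOfRecord₁₃ F N θ₀) P.K (gOfRecord₁₃ F N θ₀ P) i) ∩
      domAltOfRecord F N θ₀.ν P.K (i + 1) := by
    by_contra h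
    exact hne (hχregpt i hi U hUalt h)
  obtain ⟨hex, hun, hmem⟩ := hmemχ i hi U hU hne
  exact hnot ⟨hreg.1, (hdom (i + 1) U).2 ⟨hreg.2, hex, hun, hmem⟩⟩

/-! ## §2. How a consumer feeds the door

The door's row `hχregU` (✓p747503 `hCompT_onMembershipFamily` ∕ ✓p747700 `hCompT_onDomU`, `indA_onDomU`, `thm3Member_onDomU_of_hind`) is supplied by the ONE term
`hχregU_of_suppPt_of_memχ θ₀ P (hdom_domUOfRecord θ₀.ν εbg ρ P.K) hχregpt hmemχ`; no corollary is restated here (gate dedup: the door's three conclusions are landed once, in `…DoorAtRecord`). -/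

end Summit.QuantumFields.YangMills.BalabanUVNodes.N09MembershipSupportClauseReading

end
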